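import Summits.AtomisticToContinuum.Crystallization.Theorems.FrustratedLawDichotomyStrainedPatchTaylorChord

/-!
# The ONE-SIDED C^{1,1} chord lemma for radial functions on `ℝ³` (lens-5 g56, crux 27623 T-side, T2⁻ leaf (C⁻))

`ChordC11Signed`: exactly `…TaylorChord.ChordC11` with the two-sided bounds `|W₁′| ≤ K`, `|W₁(r)| ≤ K·r` off the finite set `J`
replaced by the ONE-SIDED bounds `−K ≤ W₁′` and `−K·r ≤ W₁(r)` — the only halves the tree proof ever used
(`chordGd_nonneg` invokes `(abs_le.1 hdW).1` and `(abs_le.1 hW1).1` and nothing else).  Conclusion unchanged: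
`W‖p‖ + D(W∘‖·‖)(p)·Δ − ½K‖Δ‖² ≤ W‖p + Δ‖` whenever the segment `p + sΔ` (`0 ≤ s ≤ 1`) has norm in `[a, b]`, `a > 0`.
This is the analytic input of the census's SIGNED curvature table `KBAND⁻` (K⁻ = max(sup(−W″)⁺, sup(−W′/s)⁺) per band,
`HOME/census/data/kband29/`), which is 20× smaller than `Kband` on the repulsive core (138 vs 2700 below 4/5) and hence
shrinks the quadratic penalty `quadTerm` of `SmoothTaylorTwo` (file `…TaylorKbandMinus`).
PROOF: the tree's §2–§4 machinery (`segR/segN/segS/segG/segGd/segH`, `mem_segExc`, `chordH_le_piece.good_of_free`) is reused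
verbatim; only `hasDerivAt_chordH`, `chordGd_nonneg`, `chordH_le_piece`, `chordH_le`, `chordC11_holds` are re-run with the signed
hypothesis (suffix `S`).  Sanity: `chordC11_of_signed : ChordC11Signed → ChordC11`.  0 sorry.
-/

open scoped BigOperators Classical

namespace Summit.AtomisticToContinuum.Crystallization.Theorems.FrustratedLawDichotomyStrainedPatchTaylorChordSigned

open Summit.AtomisticToContinuum.Crystallization.Theorems.FrustratedLawDichotomyStrainedPatchTaylorChord

/-! ## §1. The statement -/

/-- **(C⁻) `ChordC11Signed`** [REAL ANALYSIS · one-sided C^{1,1} chord lemma · TRUE-type, PROVED below] — `W` is `C¹` on `[a, b] ∋ ‖p + sΔ‖`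
(`0 ≤ s ≤ 1`, `a > 0`) and, off a finite set `J`, `W₁ = W′` is differentiable on `(a, b)` with `W₁′ ≥ −K` and `W₁(r) ≥ −K·r`; then
`W‖p‖ + D(W∘‖·‖)(p)·Δ − ½K‖Δ‖² ≤ W‖p+Δ‖`.  (Only LOWER curvature bounds enter a lower chord bound: along the chord
`g″ = W″(ρ)ρ′² + W′(ρ)(‖Δ‖² − ρ′²)/ρ ≥ −Kρ′² − K(‖Δ‖² − ρ′²) = −K‖Δ‖²`.) -/
def ChordC11Signed : Prop :=
  ∀ (W W₁ : ℝ → ℝ) (J : Finset ℝ) (K a b : ℝ) (p Δ : EuclideanSpace ℝ (Fin 3)), 0 < a → 0 ≤ K →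
    (∀ r, a ≤ r → r ≤ b → HasDerivAt W (W₁ r) r) → ContinuousOn W₁ (Set.Icc a b) →
    (∀ r, a < r → r < b → r ∉ J → HasDerivAt W₁ (deriv W₁ r) r ∧ -K ≤ deriv W₁ r ∧ -(K * r) ≤ W₁ r) →
    (∀ s ∈ Set.Icc (0 : ℝ) 1, a ≤ ‖p + s • Δ‖ ∧ ‖p + s • Δ‖ ≤ b) →
    W ‖p‖ + fderiv ℝ (fun x : EuclideanSpace ℝ (Fin 3) => W ‖x‖) p Δ - K / 2 * ‖Δ‖ ^ 2 ≤ W ‖p + Δ‖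

/-! ## §2. The signed second-order sign and the piecewise monotonicity (tree §3/§5 re-run with one-sided bounds) -/

section chord
variable {W W₁ : ℝ → ℝ} {J : Finset ℝ} {K a b : ℝ} {p Δ : (EuclideanSpace ℝ (Fin 3))}

/-- Derivative of `h = G + K‖Δ‖²·id` at a non-exceptional parameter (signed hypotheses). -/
theorem hasDerivAt_chordHS (hgood : ∀ r, a < r → r < b → r ∉ J → HasDerivAt W₁ (deriv W₁ r) r ∧ -K ≤ deriv W₁ r ∧ -(K * r) ≤ W₁ r) (ha : 0 < a)
    {s : ℝ} (h1 : a < segR p Δ s) (h2 : segR p Δ s < b) (hJ : segR p Δ s ∉ J) :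
    HasDerivAt (segH W₁ K p Δ) (segGd W₁ p Δ s + K * ‖Δ‖ ^ 2) s := by
  have h0 : segR p Δ s ≠ 0 := (ha.trans h1).ne'
  have hA : HasDerivAt (fun y => W₁ (segR p Δ y)) (deriv W₁ (segR p Δ s) * segS p Δ s) s := (hgood _ h1 h2 hJ).1.comp s (hasDerivAt_segR h0)
  have hG : HasDerivAt (segG W₁ p Δ) (segGd W₁ p Δ s) s := hA.mul (hasDerivAt_segS h0)
  have hl := ((hasDerivAt_id' s).const_mul (K * ‖Δ‖ ^ 2))
  show HasDerivAt (fun y => segG W₁ p Δ y + K * ‖Δ‖ ^ 2 * y) _ s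
  exact (hG.add hl).congr_deriv (by rw [mul_one])

/-- The second-order sign from ONE-SIDED bounds: `G′ + K‖Δ‖² ≥ 0` at good points (`W″ ≥ −K`, `W′ ≥ −Kρ`, `σ² ≤ ‖Δ‖²`, `ρ > 0`). -/
theorem chordGd_nonnegS (hgood : ∀ r, a < r → r < b → r ∉ J → HasDerivAt W₁ (deriv W₁ r) r ∧ -K ≤ deriv W₁ r ∧ -(K * r) ≤ W₁ r) (ha : 0 < a)
    {s : ℝ} (h1 : a < segR p Δ s) (h2 : segR p Δ s < b) (hJ : segR p Δ s ∉ J) : 0 ≤ segGd W₁ p Δ s + K * ‖Δ‖ ^ 2 := by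
  have h0 : 0 < segR p Δ s := ha.trans h1
  obtain ⟨-, hdW, hW1⟩ := hgood _ h1 h2 hJ
  have hσ2 := segS_sq_le h0
  have hN : segN p Δ s = segS p Δ s * segR p Δ s := by rw [segS, div_mul_cancel₀ _ h0.ne']
  have key : (‖Δ‖ ^ 2 * segR p Δ s - segN p Δ s * segS p Δ s) / segR p Δ s ^ 2 = (‖Δ‖ ^ 2 - segS p Δ s ^ 2) / segR p Δ s := by
    rw [hN]
    field_simp
  have ht : 0 ≤ (‖Δ‖ ^ 2 - segS p Δ s ^ 2) / segR p Δ s := div_nonneg (sub_nonneg.2 hσ2) h0.le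
  have e1 : -(K * segS p Δ s ^ 2) ≤ deriv W₁ (segR p Δ s) * segS p Δ s ^ 2 := by nlinarith [hdW, sq_nonneg (segS p Δ s)]
  have e2 : -(K * segR p Δ s) * ((‖Δ‖ ^ 2 - segS p Δ s ^ 2) / segR p Δ s) ≤ W₁ (segR p Δ s) * ((‖Δ‖ ^ 2 - segS p Δ s ^ 2) / segR p Δ s) :=
    mul_le_mul_of_nonneg_right hW1 ht
  have e3 : K * segR p Δ s * ((‖Δ‖ ^ 2 - segS p Δ s ^ 2) / segR p Δ s) = K * (‖Δ‖ ^ 2 - segS p Δ s ^ 2) := by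
    field_simp
  unfold segGd
  rw [key]
  nlinarith [e1, e2, e3]

/-- `h` is monotone on a closed sub-interval of `[0,1]` whose interior avoids the exceptional parameters (signed hypotheses). -/
theorem chordH_le_pieceS (hcont : ContinuousOn W₁ (Set.Icc a b)) (ha : 0 < a)
    (hgood : ∀ r, a < r → r < b → r ∉ J → HasDerivAt W₁ (deriv W₁ r) r ∧ -K ≤ deriv W₁ r ∧ -(K * r) ≤ W₁ r)
    (htube : ∀ s ∈ Set.Icc (0 : ℝ) 1, a ≤ ‖p + s • Δ‖ ∧ ‖p + s • Δ‖ ≤ b) (hΔ : Δ ≠ 0)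
    {x y : ℝ} (hx : 0 ≤ x) (hy : y ≤ 1) (hxy : x ≤ y)
    (hfree : ∀ t ∈ segExc p Δ (insert a (insert b J)), ¬ (x < t ∧ t < y)) :
    segH W₁ K p Δ x ≤ segH W₁ K p Δ y := by
  have hsub : Set.Icc x y ⊆ Set.Icc 0 1 := Set.Icc_subset_Icc hx hy
  have hmono : MonotoneOn (segH W₁ K p Δ) (Set.Icc x y) := by
    refine monotoneOn_of_hasDerivWithinAt_nonneg (convex_Icc x y) ((continuousOn_chordH hcont ha htube).mono hsub)
      (f' := fun s => segGd W₁ p Δ s + K * ‖Δ‖ ^ 2) ?_ ?_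
    · intro s hs
      rw [interior_Icc] at hs
      have hs01 : s ∈ Set.Icc (0:ℝ) 1 := ⟨hx.trans hs.1.le, hs.2.le.trans hy⟩
      have hgoodS := chordH_le_piece.good_of_free ha htube hΔ hfree hs hs01
      exact (hasDerivAt_chordHS hgood ha hgoodS.1 hgoodS.2.1 hgoodS.2.2).hasDerivWithinAt
    · intro s hs
      rw [interior_Icc] at hs
      have hs01 : s ∈ Set.Icc (0:ℝ) 1 := ⟨hx.trans hs.1.le, hs.2.le.trans hy⟩
      have hgoodS := chordH_le_piece.good_of_free ha htube hΔ hfree hs hs01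
      exact chordGd_nonnegS hgood ha hgoodS.1 hgoodS.2.1 hgoodS.2.2
  exact hmono (Set.left_mem_Icc.2 hxy) (Set.right_mem_Icc.2 hxy) hxy

/-- `h 0 ≤ h 1` piece by piece (induction over the finitely many exceptional parameters; signed hypotheses). -/
theorem chordH_leS (hcont : ContinuousOn W₁ (Set.Icc a b)) (ha : 0 < a)
    (hgood : ∀ r, a < r → r < b → r ∉ J → HasDerivAt W₁ (deriv W₁ r) r ∧ -K ≤ deriv W₁ r ∧ -(K * r) ≤ W₁ r)
    (htube : ∀ s ∈ Set.Icc (0 : ℝ) 1, a ≤ ‖p + s • Δ‖ ∧ ‖p + s • Δ‖ ≤ b) (hΔ : Δ ≠ 0) :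
    ∀ n : ℕ, ∀ x y : ℝ, 0 ≤ x → y ≤ 1 → x ≤ y →
      ((segExc p Δ (insert a (insert b J))).filter (fun t => x < t ∧ t < y)).card ≤ n → segH W₁ K p Δ x ≤ segH W₁ K p Δ y := by
  intro n
  induction n with
  | zero =>
    intro x y hx hy hxy hcard
    have hemp := Finset.card_eq_zero.1 (Nat.le_zero.1 hcard)
    refine chordH_le_pieceS hcont ha hgood htube hΔ hx hy hxy fun t ht hxt => ?_
    have : t ∈ (segExc p Δ (insert a (insert b J))).filter (fun t => x < t ∧ t < y) := Finset.mem_filter.2 ⟨ht, hxt⟩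
    rw [hemp] at this
    exact absurd this (Finset.notMem_empty t)
  | succ n ih =>
    intro x y hx hy hxy hcard
    by_cases hex : ∃ t ∈ segExc p Δ (insert a (insert b J)), x < t ∧ t < y
    · obtain ⟨t, ht, hxt, hty⟩ := hex
      set T := (segExc p Δ (insert a (insert b J))).filter (fun t => x < t ∧ t < y) with hT
      have htT : t ∈ T := Finset.mem_filter.2 ⟨ht, hxt, hty⟩
      have hc1 : ((segExc p Δ (insert a (insert b J))).filter (fun u => x < u ∧ u < t)).card ≤ n := by
        have hsub : (segExc p Δ (insert a (insert b J))).filter (fun u => x < u ∧ u < t) ⊆ T.erase t := by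
          intro u hu
          obtain ⟨hu1, hu2, hu3⟩ := Finset.mem_filter.1 hu
          exact Finset.mem_erase.2 ⟨hu3.ne, Finset.mem_filter.2 ⟨hu1, hu2, hu3.trans hty⟩⟩
        have := Finset.card_le_card hsub
        rw [Finset.card_erase_of_mem htT] at this
        omega
      have hc2 : ((segExc p Δ (insert a (insert b J))).filter (fun u => t < u ∧ u < y)).card ≤ n := by
        have hsub : (segExc p Δ (insert a (insert b J))).filter (fun u => t < u ∧ u < y) ⊆ T.erase t := by
          intro u hu
          obtain ⟨hu1, hu2, hu3⟩ := Finset.mem_filter.1 hu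
          exact Finset.mem_erase.2 ⟨hu2.ne', Finset.mem_filter.2 ⟨hu1, hxt.trans hu2, hu3⟩⟩
        have := Finset.card_le_card hsub
        rw [Finset.card_erase_of_mem htT] at this
        omega
      exact (ih x t hx (hty.le.trans hy) hxt.le hc1).trans (ih t y (hx.trans hxt.le) hy hty.le hc2)
    · exact chordH_le_pieceS hcont ha hgood htube hΔ hx hy hxy fun t ht hxt => hex ⟨t, ht, hxt⟩

end chord

/-! ## §3. The theorem -/

/-- ★★★ **(C⁻) PROVED**: the one-sided C^{1,1} chord lemma `ChordC11Signed` (tree `chordC11_holds` re-run on `chordH_leS`). [folklore] -/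
theorem chordC11Signed_holds : ChordC11Signed := by
  intro W W₁ J K a b p Δ ha hK hW hcont hgood htube
  by_cases hΔ : Δ = 0
  · subst hΔ; simp
  have hp01 : ∀ s ∈ Set.Icc (0:ℝ) 1, a ≤ segR p Δ s ∧ segR p Δ s ≤ b := htube
  have hg : ∀ s ∈ Set.Icc (0:ℝ) 1, HasDerivAt (fun y => W (segR p Δ y)) (segG W₁ p Δ s) s :=
    fun s hs => hasDerivAt_chordG hW ha (hp01 s hs).1 (hp01 s hs).2
  have hmon : ∀ s ∈ Set.Icc (0:ℝ) 1, segH W₁ K p Δ 0 ≤ segH W₁ K p Δ s := fun s hs =>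
    chordH_leS hcont ha hgood htube hΔ _ 0 s le_rfl hs.2 hs.1 le_rfl
  set Φ : ℝ → ℝ := fun s => W (segR p Δ s) - segG W₁ p Δ 0 * s + K * ‖Δ‖ ^ 2 / 2 * s ^ 2 with hΦ
  have hΦd : ∀ s ∈ Set.Icc (0:ℝ) 1, HasDerivAt Φ (segG W₁ p Δ s - segG W₁ p Δ 0 + K * ‖Δ‖ ^ 2 * s) s := by
    intro s hs
    have h1 := (hg s hs).sub ((hasDerivAt_id' s).const_mul (segG W₁ p Δ 0))
    have h2 := ((hasDerivAt_pow 2 s).const_mul (K * ‖Δ‖ ^ 2 / 2))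
    have h := h1.add h2
    refine h.congr_deriv ?_
    simp; ring
  have hΦmono : MonotoneOn Φ (Set.Icc 0 1) := by
    refine monotoneOn_of_hasDerivWithinAt_nonneg (convex_Icc 0 1) ?_ (fun s hs => (hΦd s (interior_subset hs)).hasDerivWithinAt) ?_
    · exact fun s hs => (hΦd s hs).continuousAt.continuousWithinAt
    · intro s hs
      rw [interior_Icc] at hs
      have := hmon s ⟨hs.1.le, hs.2.le⟩
      simp only [segH] at this
      linarith
  have h01 := hΦmono (Set.left_mem_Icc.2 zero_le_one) (Set.right_mem_Icc.2 zero_le_one) zero_le_one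
  simp only [hΦ] at h01
  have hρ0 : segR p Δ 0 = ‖p‖ := by simp [segR]
  have hρ1 : segR p Δ 1 = ‖p + Δ‖ := by simp [segR]
  have hp0 : p ≠ 0 := by
    intro h; have := (hp01 0 (Set.left_mem_Icc.2 zero_le_one)).1; rw [hρ0, h, norm_zero] at this; linarith
  have hpa : a ≤ ‖p‖ ∧ ‖p‖ ≤ b := by simpa [hρ0] using hp01 0 (Set.left_mem_Icc.2 zero_le_one)
  have hnorm : HasFDerivAt (fun x : (EuclideanSpace ℝ (Fin 3)) => ‖x‖) (fderiv ℝ (fun x : (EuclideanSpace ℝ (Fin 3)) => ‖x‖) p) p :=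
    ((differentiableAt_id).norm ℝ hp0).hasFDerivAt
  have hF : HasFDerivAt (fun x : (EuclideanSpace ℝ (Fin 3)) => W ‖x‖) (W₁ ‖p‖ • fderiv ℝ (fun x : (EuclideanSpace ℝ (Fin 3)) => ‖x‖) p) p :=
    (hW ‖p‖ hpa.1 hpa.2).comp_hasFDerivAt p hnorm
  have hpt : p + (0:ℝ) • Δ = p := by simp
  have hF0 : HasFDerivAt (fun x : (EuclideanSpace ℝ (Fin 3)) => W ‖x‖) (W₁ ‖p‖ • fderiv ℝ (fun x : (EuclideanSpace ℝ (Fin 3)) => ‖x‖) p) (p + (0:ℝ) • Δ) := by rw [hpt]; exact hF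
  have hline : HasDerivAt (fun s : ℝ => p + s • Δ) Δ 0 := by
    simpa using ((hasDerivAt_id' (0:ℝ)).smul_const Δ).const_add p
  have hcomp := hF0.comp_hasDerivAt (0:ℝ) hline
  have hg0 : HasDerivAt (fun y => W (segR p Δ y)) (segG W₁ p Δ 0) 0 := hg 0 (Set.left_mem_Icc.2 zero_le_one)
  have hG0 : segG W₁ p Δ 0 = (W₁ ‖p‖ • fderiv ℝ (fun x : (EuclideanSpace ℝ (Fin 3)) => ‖x‖) p) Δ := hg0.unique hcomp
  rw [hF.fderiv, ← hG0]
  rw [hρ0, hρ1] at h01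
  linarith

/-- Sanity (the signed lemma implies the tree's two-sided one): `ChordC11Signed → ChordC11`. -/
theorem chordC11_of_signed (h : ChordC11Signed) : ChordC11 :=
  fun W W₁ J K a b p Δ ha hK hW hcont hgood htube =>
    h W W₁ J K a b p Δ ha hK hW hcont (fun r h1 h2 hJ => ⟨(hgood r h1 h2 hJ).1, (abs_le.1 (hgood r h1 h2 hJ).2.1).1, (abs_le.1 (hgood r h1 h2 hJ).2.2).1⟩) htube

end Summit.AtomisticToContinuum.Crystallization.Theorems.FrustratedLawDichotomyStrainedPatchTaylorChordSigned
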